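import Summits.BirchSwinnertonDyer.BirchSwinnertonDyer.Theorems.GenusKolyvaginAtTwoEquivariantKolyvaginExactAtTwoPropFourFourRat
import Summits.BirchSwinnertonDyer.BirchSwinnertonDyer.Theorems.ByReductionTypeAtTwoRankOneAtTwoOffBigImageOddLocalEngineRegularKolyvaginPrimeDictionary
import HarnessLib

/-!
# Route `ByReductionTypeAtTwo`, crux `RankOneAtTwoOffBigImageOddLocal` (stmt-BirchSwinnertonDyer-23716), line
# `refined_kolyvagin_tamagawa_shift_at_two`, stub `stub_sigmaShiftPosDisc`: McCallum's Prop. 4.4 OVER `ℚ` for the pair `(E, E^{(c)})` at a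
# **REGULAR** Kolyvagin prime — no sign condition on `Δ`

Lead prover `prover-cruxlead-stmt-BirchSwinnertonDyer-23716-g4` (2026-08-28; `--supports` the crux, closes nothing).  Fourth regular-engine CONSUMER.
The sibling route's `GenusExact.SelmerDescent.zsmul_twist_mem_selmerLocalKer_iff_zsmul_mem_torsionLocalKer_of_K` /
`zsmul_mem_selmerLocalKer_iff_zsmul_twist_mem_torsionLocalKer_of_K` (seat `bsd-line-gk2-p3`; fields `c_mem_loc_iff₁₂` / `c_mem_loc_iff₂₁` of the pair
descent `KolyvaginDescent.VisiblePairHypothesesM`) move the Kolyvagin relation at `2` (Q2, McCallum Prop. 4.4 over `K` at `λ`) down to `ℚ` at a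
Gross–Kolyvagin prime; their only `Δ < 0` / `Frob(ℓ) = Frob(∞)` input is the Kolyvagin-prime dictionary, which `…EngineRegularKolyvaginPrimeDictionary`
(p665359) now provides at a REGULAR Kolyvagin prime on either sign of `Δ`.  Here are the two fields with that input swapped:

* `zsmul_twist_mem_selmerLocalKer_iff_zsmul_mem_torsionLocalKer_of_K_regular` (`c_mem_loc_iff₁₂`, even depth `m` → odd depth `ℓm`): regular datum for `E`;
* `zsmul_mem_selmerLocalKer_iff_zsmul_twist_mem_torsionLocalKer_of_K_regular` (`c_mem_loc_iff₂₁`): regular datum for the twin `E^{(c)}` (for `c = d_K` it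
  follows from `E`'s — the twin has the same `E[q]` up to the character of `K`, so a Frobenius inert in `K` acts on `E^{(c)}[q]` as `−h`, again an
  involution moving a `2`-torsion point; that transfer is the regular analogue of the sibling's `…TwinGrossPrimes`, NOT in this file).

THEOREMS ONLY (no definition, no named fact, no `sorry`, standard axioms).  BSD is not proved by any of this; the crux is not proved; the stub is not proved.

References: [McCallumLMS1991] §4 Prop. 4.4, Lemma 4.3, §5; [GrossLMS1991] Prop. 6.2, §9; [Kolyvagin1989Izv] §3; [SilvermanAEC2009] X.§4, X.5 Cor. 5.4.
-/

set_option autoImplicit false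
set_option linter.dupNamespace false -- tree convention: `Summit.BirchSwinnertonDyer.BirchSwinnertonDyer.Theorems` (summit = sub-problem)

noncomputable section

open scoped Classical

namespace Summit.BirchSwinnertonDyer.BirchSwinnertonDyer.Theorems.OffBigImageOddLocalAtTwo.Engine

open WeierstrassCurve NumberField IsDedekindDomain Field
open Literature.NumberTheory.EllipticCurves Literature.NumberTheory.GaloisRepresentations
open Summit.BirchSwinnertonDyer.BirchSwinnertonDyer.Theorems.GenusExact.FrobeniusCriterion
open Summit.BirchSwinnertonDyer.BirchSwinnertonDyer.Theorems.GenusExact.EigenClassesFinite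
open Summit.BirchSwinnertonDyer.BirchSwinnertonDyer.Theorems.GenusExact.SelmerDescent

variable {K : Type} [Field K] [NumberField K] (W : WeierstrassCurve ℚ) [W.IsElliptic]

/-- **Field `c_mem_loc_iff₁₂` at a REGULAR Kolyvagin prime — Prop. 4.4 over `ℚ`, even depth `m` → odd depth `ℓm`.**  Data as in the sibling's
`zsmul_twist_mem_selmerLocalKer_iff_zsmul_mem_torsionLocalKer_of_K` with (`Δ(E) < 0`, `FrobEqFrobInfty W K q ℓ`) replaced by: some arithmetic Frobenius at
some `𝔓₀ ∣ ℓ` acts on `E[q]` as an involution moving a `2`-torsion point.  Classes: `c_K, c_K' ∈ H¹(K, E_K[q])`, `u ∈ H¹(ℚ, E[q])` with `res u = c_K`,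
`y ∈ H¹(ℚ, E^{(c)}[q])` with `hPsiKT (res y) = c_K'`; HYPOTHESIS `hRel` (Q2 over `K` at `λ = w`): `c'·c_K' ∈ selmerLocalKer_w ⟺ c'·c_K ∈ torsionLocalKer_w`.
CONCLUSION: **`c'·y ∈ selmerLocalKer_v(E^{(c)}/ℚ) ⟺ c'·u ∈ torsionLocalKer_v(E/ℚ)`**. [cite: McCallumLMS1991, §4 Prop. 4.4] [cite: Kolyvagin1989Izv, §3] -/
theorem zsmul_twist_mem_selmerLocalKer_iff_zsmul_mem_torsionLocalKer_of_K_regular {M : ℕ}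
    (hM : 1 ≤ M) {q : ℕ} (hq : q = 2 ^ M) {ℓ : ℕ} (hℓ : ℓ.Prime) (hℓ2 : ℓ ≠ 2)
    {v : HeightOneSpectrum (𝓞 ℚ)} (hℓv : (ℓ : 𝓞 ℚ) ∈ v.asIdeal) (hgood : W.HasGoodReductionAt v)
    (h2K : Module.finrank ℚ K = 2) {θ₀ : K} (hθ₀ : θ₀ ∉ (algebraMap ℚ K).range) {c₀ : ℤ}
    (hc₀ : θ₀ ^ 2 = algebraMap ℚ K c₀) (hc₀v : ((c₀ : ℤ) : 𝓞 ℚ) ∉ v.asIdeal)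
    (hreg : ∃ (𝔓₀ : Ideal (absIntegers (𝓞 ℚ) ℚ)) (h : absoluteGaloisGroup ℚ), 𝔓₀ ∈ v.primesAbove ∧
      IsArithFrobAt (𝓞 ℚ) h 𝔓₀ ∧ (∀ X : geomTorsion W (q : ℤ), h • h • X = X) ∧ ∃ u : geomTorsion W 2, h • u ≠ u)
    (w : HeightOneSpectrum (𝓞 K)) [w.asIdeal.LiesOver v.asIdeal]
    (hf : w.asIdeal.inertiaDeg (𝓞 ℚ) = 2)
    {θ : K} {c : ℚ} (hθ : θ ∉ Set.range (algebraMap ℚ K)) (hc : θ ^ 2 = algebraMap ℚ K c)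
    [(W.quadraticTwist c).IsElliptic] (hgood' : (W.quadraticTwist c).HasGoodReductionAt v)
    {cK cK' : galH1Torsion (W.baseChange K) (q : ℤ)} {u : galH1Torsion W (q : ℤ)}
    {y : galH1Torsion (W.quadraticTwist c) (q : ℤ)} (hu : resTorsion W K (q : ℤ) u = cK)
    (hy : hPsiKT W K hθ hc (q : ℤ) (resTorsion (W.quadraticTwist c) K (q : ℤ) y) = cK') (c' : ℤ)
    (hRel : c' • cK' ∈ selmerLocalKer (W.baseChange K) (w.adicCompletion K) (q : ℤ) ↔
      c' • cK ∈ (W.baseChange K).torsionLocalKer (w.adicCompletion K) (q : ℤ)) :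
    c' • y ∈ selmerLocalKer (W.quadraticTwist c) (v.adicCompletion ℚ) (q : ℤ) ↔
      c' • u ∈ W.torsionLocalKer (v.adicCompletion ℚ) (q : ℤ) := by
  obtain ⟨h2v, hqv⟩ := two_notMem_and_natCast_two_pow_notMem hq hℓ hℓ2 hℓv
  rw [zsmul_mem_selmerLocalKer_iff_resTorsion (W.quadraticTwist c) h2K hθ₀ hc₀ (q : ℤ) v w hgood' hqv
      h2v hc₀v y c',
    zsmul_mem_selmerLocalKer_iff_hPsiKT_mem W K hθ hc (q : ℤ) (w.adicCompletion K) _ c', hy, hRel, ← hu]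
  exact (zsmul_mem_torsionLocalKer_iff_resTorsion_of_notMem_regular W hM hq hℓ hℓ2 hℓv hgood h2K hθ₀ hc₀
    hc₀v hreg w hf u c').symm

/-- **Field `c_mem_loc_iff₂₁` at a REGULAR Kolyvagin prime — Prop. 4.4 over `ℚ`, odd depth `m` → even depth `ℓm`.**  As the sibling's
`zsmul_mem_selmerLocalKer_iff_zsmul_twist_mem_torsionLocalKer_of_K`, with the twin's (`Δ(E^{(c)}) < 0`, `FrobEqFrobInfty (E^{(c)}) K q ℓ`) replaced by a regular
datum for the twin `E^{(c)}` (a Frobenius at some `𝔓₀ ∣ ℓ` acting on `E^{(c)}[q]` as an involution moving a `2`-torsion point).  Classes: `u' ∈ H¹(ℚ, E[q])`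
with `res u' = c_K'`, `y' ∈ H¹(ℚ, E^{(c)}[q])` with `hPsiKT (res y') = c_K`; `hRel` as before.  CONCLUSION: **`c'·u' ∈ selmerLocalKer_v(E/ℚ) ⟺ c'·y' ∈
torsionLocalKer_v(E^{(c)}/ℚ)`**. [cite: McCallumLMS1991, §4 Prop. 4.4] [cite: Kolyvagin1989Izv, §3] -/
theorem zsmul_mem_selmerLocalKer_iff_zsmul_twist_mem_torsionLocalKer_of_K_regular {M : ℕ} (hM : 1 ≤ M)
    {q : ℕ} (hq : q = 2 ^ M) {ℓ : ℕ} (hℓ : ℓ.Prime) (hℓ2 : ℓ ≠ 2) {v : HeightOneSpectrum (𝓞 ℚ)}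
    (hℓv : (ℓ : 𝓞 ℚ) ∈ v.asIdeal) (hgood : W.HasGoodReductionAt v) (h2K : Module.finrank ℚ K = 2)
    {θ₀ : K} (hθ₀ : θ₀ ∉ (algebraMap ℚ K).range) {c₀ : ℤ} (hc₀ : θ₀ ^ 2 = algebraMap ℚ K c₀)
    (hc₀v : ((c₀ : ℤ) : 𝓞 ℚ) ∉ v.asIdeal) (w : HeightOneSpectrum (𝓞 K))
    [w.asIdeal.LiesOver v.asIdeal] (hf : w.asIdeal.inertiaDeg (𝓞 ℚ) = 2)
    {θ : K} {c : ℚ} (hθ : θ ∉ Set.range (algebraMap ℚ K)) (hc : θ ^ 2 = algebraMap ℚ K c)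
    [(W.quadraticTwist c).IsElliptic] (hgood' : (W.quadraticTwist c).HasGoodReductionAt v)
    (hreg' : ∃ (𝔓₀ : Ideal (absIntegers (𝓞 ℚ) ℚ)) (h : absoluteGaloisGroup ℚ), 𝔓₀ ∈ v.primesAbove ∧
      IsArithFrobAt (𝓞 ℚ) h 𝔓₀ ∧ (∀ X : geomTorsion (W.quadraticTwist c) (q : ℤ), h • h • X = X) ∧
      ∃ u : geomTorsion (W.quadraticTwist c) 2, h • u ≠ u)
    {cK cK' : galH1Torsion (W.baseChange K) (q : ℤ)} {u' : galH1Torsion W (q : ℤ)}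
    {y' : galH1Torsion (W.quadraticTwist c) (q : ℤ)} (hu' : resTorsion W K (q : ℤ) u' = cK')
    (hy' : hPsiKT W K hθ hc (q : ℤ) (resTorsion (W.quadraticTwist c) K (q : ℤ) y') = cK) (c' : ℤ)
    (hRel : c' • cK' ∈ selmerLocalKer (W.baseChange K) (w.adicCompletion K) (q : ℤ) ↔
      c' • cK ∈ (W.baseChange K).torsionLocalKer (w.adicCompletion K) (q : ℤ)) :
    c' • u' ∈ selmerLocalKer W (v.adicCompletion ℚ) (q : ℤ) ↔
      c' • y' ∈ (W.quadraticTwist c).torsionLocalKer (v.adicCompletion ℚ) (q : ℤ) := by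
  obtain ⟨h2v, hqv⟩ := two_notMem_and_natCast_two_pow_notMem hq hℓ hℓ2 hℓv
  rw [zsmul_mem_selmerLocalKer_iff_resTorsion W h2K hθ₀ hc₀ (q : ℤ) v w hgood hqv h2v hc₀v u' c', hu',
    hRel, ← hy', ← zsmul_mem_torsionLocalKer_iff_hPsiKT_mem W K hθ hc (q : ℤ) (w.adicCompletion K) _ c']
  exact (zsmul_mem_torsionLocalKer_iff_resTorsion_of_notMem_regular (W.quadraticTwist c) hM hq hℓ hℓ2 hℓv
    hgood' h2K hθ₀ hc₀ hc₀v hreg' w hf y' c').symm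

end Summit.BirchSwinnertonDyer.BirchSwinnertonDyer.Theorems.OffBigImageOddLocalAtTwo.Engine

end
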